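import Summits.CriticalPhenomena.SAWScalingLimit.Theorems.SAWRenewalTightnessSubseqIdentificationCompensatorMassLowerBound
import Literature.Probability.RandomPlanarGeometry.LoewnerDriverUniformStability
import Literature.Probability.RandomPlanarGeometry.LoewnerSlidHullStar
import HarnessLib

/-!
# Tube robustness of the compensator lower bound (line `boundary-area-law`, stub L3b)

Line `boundary-area-law` of the crux `SubseqIdentification` (stmt-CriticalPhenomena-0783), lead
c5's reshape r-c5-1 of L3 (essential unboundedness of the LSW compensator
`L^A = ∫ m(A_s − W_s) ds`, `m = starBubbleMass`, `A_s − W_s = Loewner.slidHull W A s`). This file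
proves the DETERMINISTIC stub L3b `stub_compensatorTube`:

if a `*`-hull `A` is alive at time `S` under a continuous driving function `U`, `a ∈ A ∩ ℍ`, and
the certified integrand `(Im Z_s/|Z_s|²)²/2`, `Z_s = g^U_s(a) − U_s`, integrates to `≥ 4q` on
`(0, S]`, then for some `η > 0` EVERY continuous `W` with `|W − U| ≤ η` on `[0, S]` keeps all of
`A` alive at `S` and has `∫_{(0,S]} m(A_s − W_s) ds ≥ q`.

Proof. Let `m₀ = min_{[0,S]} Im Z_s > 0` (the solution from `a` is continuous and stays in `ℍ`).
Kemppainen–Smirnov's Lemma 5.4 (`Loewner.exists_forall_dist_map_le_of_driving_close`, uniform on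
the compact `A`, real points included) with `ε = m₀/16` gives `η₁`; take `η = min η₁ (m₀/16)`.
For `W` in the tube, `Z^W_s = g^W_s(a) − W_s` is within `m₀/8` of `Z_s`, so `Im Z^W ≥ (7/8) Im Z`
and `|Z^W| ≤ (9/8)|Z|`, whence `(Im Z^W/|Z^W|²)²/2 ≥ (56/81)² (Im Z/|Z|²)²/2 ≥ (1/4)·(Im Z/|Z|²)²/2`;
and `m(A_s − W_s) ≥ (Im Z^W/|Z^W|²)²/2` by the mass-from-one-point bound
`sq_div_le_starBubbleMass` for the `*`-hull `A_s − W_s` (`Loewner.isStarHull_slidHull_of_disjoint`)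
containing `Z^W_s`. Integrating (`lintegral_const_mul_le`, no measurability needed) gives
`ofReal q ≤ (1/4) ∫ ofReal(certified) ≤ ∫ m`.

References: A. Kemppainen, S. Smirnov, *Random curves, scaling limits and Loewner evolutions*,
Ann. Probab. 45 (2017), App. A Lemma 5.4; G. F. Lawler, O. Schramm, W. Werner, *Conformal
restriction: the chordal case*, J. Amer. Math. Soc. 16 (2003), §5 eq. (5.1). No named fact is used.
-/

noncomputable section

open MeasureTheory Filter Topology Set Metric
open scoped NNReal ENNReal
open Literature.Probability.RandomPlanarGeometry

namespace Summit.CriticalPhenomena.SAWScalingLimit.Theorems.SubseqIdentification.BoundaryAreaLaw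

/-! ### The pointwise comparison of certified integrands -/

/-- **Perturbing `Z` by at most `(min Im Z)/8` costs at most a factor `4` in `(Im Z/|Z|²)²/2`.**
If `0 < m ≤ Im Z` and `‖Z' − Z‖ ≤ m/8`, then `Im Z' > 0` and
`(1/4)·(Im Z/|Z|²)²/2 ≤ (Im Z'/|Z'|²)²/2` (`Im Z' ≥ (7/8) Im Z`, `|Z'| ≤ (9/8)|Z|`,
`(56/81)² ≥ 1/4`). [folklore] -/
theorem quarter_sq_div_le_of_near_c5 {Z Z' : ℂ} {m : ℝ} (hm : 0 < m) (hmZ : m ≤ Z.im)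
    (hd : ‖Z' - Z‖ ≤ m / 8) :
    0 < Z'.im ∧
      1 / 4 * ((Z.im / Complex.normSq Z) ^ 2 / 2) ≤ (Z'.im / Complex.normSq Z') ^ 2 / 2 := by
  have hy0 : 0 < Z.im := hm.trans_le hmZ
  have hyn : Z.im ≤ ‖Z‖ := Complex.im_le_norm Z
  have hdy : ‖Z' - Z‖ ≤ Z.im / 8 := hd.trans (by linarith)
  have hy'ge : Z.im - ‖Z' - Z‖ ≤ Z'.im := by
    have h1 : |(Z' - Z).im| ≤ ‖Z' - Z‖ := Complex.abs_im_le_norm _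
    rw [Complex.sub_im] at h1
    linarith [(abs_le.1 h1).1]
  have hn'le : ‖Z'‖ ≤ ‖Z‖ + ‖Z' - Z‖ := norm_le_norm_add_norm_sub' Z' Z
  have hy'0 : 0 < Z'.im := by linarith
  have hn'0 : 0 < ‖Z'‖ := hy'0.trans_le (Complex.im_le_norm Z')
  have hn0 : 0 < ‖Z‖ := hy0.trans_le hyn
  refine ⟨hy'0, ?_⟩
  rw [Complex.normSq_eq_norm_sq Z, Complex.normSq_eq_norm_sq Z']
  have key : Z.im / ‖Z‖ ^ 2 / 2 ≤ Z'.im / ‖Z'‖ ^ 2 := by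
    rw [div_div, div_le_div_iff₀ (by positivity) (by positivity)]
    have h1 : ‖Z'‖ ≤ 9 / 8 * ‖Z‖ := by linarith
    have h2 : ‖Z'‖ ^ 2 ≤ (9 / 8 * ‖Z‖) ^ 2 := pow_le_pow_left₀ hn'0.le h1 2
    have h3 : Z.im * ‖Z'‖ ^ 2 ≤ Z.im * (9 / 8 * ‖Z‖) ^ 2 := mul_le_mul_of_nonneg_left h2 hy0.le
    have h4 : 7 / 8 * Z.im ≤ Z'.im := by linarith
    have h5 : 7 / 8 * Z.im * (‖Z‖ ^ 2 * 2) ≤ Z'.im * (‖Z‖ ^ 2 * 2) :=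
      mul_le_mul_of_nonneg_right h4 (by positivity)
    nlinarith [h3, h5, mul_nonneg hy0.le (sq_nonneg ‖Z‖)]
  have hq : 0 ≤ Z.im / ‖Z‖ ^ 2 / 2 := by positivity
  have hsq : (Z.im / ‖Z‖ ^ 2 / 2) ^ 2 ≤ (Z'.im / ‖Z'‖ ^ 2) ^ 2 := pow_le_pow_left₀ hq key 2
  calc 1 / 4 * ((Z.im / ‖Z‖ ^ 2) ^ 2 / 2) = (Z.im / ‖Z‖ ^ 2 / 2) ^ 2 / 2 := by ring
    _ ≤ (Z'.im / ‖Z'‖ ^ 2) ^ 2 / 2 := by linarith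

/-! ### The registered stub -/

/-- **L3b — TUBE ROBUSTNESS (deterministic).** Exact steering data are stable under a sup-norm
perturbation of the driver: if `A ∈ 𝒬*` is alive at `S` under the continuous `U`, `a ∈ A ∩ ℍ`, and
the certified integrand of `a` integrates to `≥ 4q` on `(0, S]`, then for some `η > 0` EVERY
continuous `W` with `|W − U| ≤ η` on `[0, S]` keeps all of `A` alive at `S` and has compensator
`∫_{(0,S]} m(A_s − W_s) ds ≥ q` (Kemppainen–Smirnov Lemma 5.4
`Loewner.exists_forall_dist_map_le_of_driving_close` on the compact `A` with
`ε = (min_{[0,S]} Im Z)/16`; then `Im Z^W ≥ (7/8) Im Z`, `|Z^W| ≤ (9/8)|Z|`, and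
`m(A_s − W_s) ≥ (Im Z^W/|Z^W|²)²/2` by `sq_div_le_starBubbleMass` for the `*`-hull
`Loewner.slidHull W A s` (`Loewner.isStarHull_slidHull_of_disjoint`) containing `Z^W_s = g^W_s(a) − W_s`).
[cite: KemppainenSmirnov2017, App. A Lemma 5.4] [cite: LawlerSchrammWerner2003Restriction, §5 eq. (5.1)] -/
theorem stub_compensatorTube :
    ∀ (A : Set ℂ), IsStarHull A → ∀ (U : ℝ≥0 → ℝ) (S : ℝ≥0) (a : ℂ) (q : ℝ),
      Continuous U → a ∈ A → 0 < a.im →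
      (∀ z ∈ A, (S : WithTop ℝ≥0) < Loewner.swallowingTime U z) →
      ENNReal.ofReal (4 * q) ≤ ∫⁻ s in Set.Ioc (0 : ℝ) S,
          ENNReal.ofReal (((Loewner.map U s.toNNReal a - U s.toNNReal).im /
            Complex.normSq (Loewner.map U s.toNNReal a - U s.toNNReal)) ^ 2 / 2) →
      ∃ η : ℝ, 0 < η ∧ ∀ (W : ℝ≥0 → ℝ), Continuous W → (∀ s : ℝ≥0, s ≤ S → |W s - U s| ≤ η) →
        (∀ z ∈ A, (S : WithTop ℝ≥0) < Loewner.swallowingTime W z) ∧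
        ENNReal.ofReal q ≤ ∫⁻ s in Set.Ioc (0 : ℝ) S,
          ENNReal.ofReal (starBubbleMass (Loewner.slidHull W A s.toNNReal)) := by
  intro A hA U S a q hU ha hai halive hint
  -- the solution from `a` under `U`, alive beyond `S`
  have hST : (S : WithTop ℝ≥0) < Loewner.swallowingTime U a := halive a ha
  have ha0 : a ≠ U 0 := fun h0 ↦ by
    have := congrArg Complex.im h0
    rw [Complex.ofReal_im] at this
    exact hai.ne' this
  obtain ⟨g, hg⟩ := Loewner.exists_isSolution_swallowingTime_holds hU ha0
  set T := Loewner.swallowingTime U a with hTdef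
  have hST' : (((S : ℝ)).toNNReal : WithTop ℝ≥0) < T := by rwa [Real.toNNReal_coe]
  have hIcc : Icc (0 : ℝ) S ⊆ {t : ℝ | 0 ≤ t ∧ (t.toNNReal : WithTop ℝ≥0) < T} :=
    Loewner.Icc_subset_timeDomain hST'
  have hgc : ContinuousOn g (Icc (0 : ℝ) S) := hg.continuousOn.mono hIcc
  have hgim : ∀ x ∈ Icc (0 : ℝ) S, 0 < (g x).im := fun x hx ↦
    Loewner.IsSolution.im_pos_holds hU hg hai x hx.1 (hIcc hx).2
  have hmap : ∀ x ∈ Icc (0 : ℝ) S, Loewner.map U x.toNNReal a = g x := fun x hx ↦ by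
    rw [Loewner.map_eq_of_isSolution hU hg (hIcc hx).2, Real.coe_toNNReal _ hx.1]
  -- the minimal height `m₀ > 0` of the trajectory on `[0, S]`
  obtain ⟨m₀, hm₀, hm₀le⟩ := (isCompact_Icc (a := (0 : ℝ)) (b := (S : ℝ))).exists_forall_le'
    (Complex.continuous_im.comp_continuousOn hgc) (a := (0 : ℝ)) hgim
  -- Kemppainen–Smirnov Lemma 5.4 on the compact `A`
  have hε : (0 : ℝ) < m₀ / 16 := by positivity
  obtain ⟨η₁, hη₁, hKS⟩ := Loewner.exists_forall_dist_map_le_of_driving_close hU (b := S)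
    hA.isBoundedHull.isCompact halive hε
  refine ⟨min η₁ (m₀ / 16), lt_min hη₁ hε, fun W hW htube ↦ ?_⟩
  have htube' : ∀ s : ℝ≥0, s ≤ S → |U s - W s| ≤ η₁ := fun s hs ↦ by
    rw [abs_sub_comm]; exact (htube s hs).trans (min_le_left _ _)
  have hKSW := hKS W hW htube'
  have haliveW : ∀ z ∈ A, (S : WithTop ℝ≥0) < Loewner.swallowingTime W z := fun z hz ↦ (hKSW z hz).1
  refine ⟨haliveW, ?_⟩
  -- pointwise: a quarter of the certified integrand is below the mass
  have hpt : ∀ s ∈ Ioc (0 : ℝ) S,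
      ENNReal.ofReal (1 / 4) * ENNReal.ofReal (((Loewner.map U s.toNNReal a - U s.toNNReal).im /
          Complex.normSq (Loewner.map U s.toNNReal a - U s.toNNReal)) ^ 2 / 2) ≤
        ENNReal.ofReal (starBubbleMass (Loewner.slidHull W A s.toNNReal)) := by
    intro s hs
    have hs0 : 0 ≤ s := hs.1.le
    have hsI : s ∈ Icc (0 : ℝ) S := ⟨hs0, hs.2⟩
    have hs'S : s.toNNReal ≤ S := Real.toNNReal_le_iff_le_coe.2 hs.2
    set Z : ℂ := Loewner.map U s.toNNReal a - U s.toNNReal with hZ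
    set Z' : ℂ := Loewner.map W s.toNNReal a - W s.toNNReal with hZ'
    -- `Im Z ≥ m₀`
    have hZim : m₀ ≤ Z.im := by
      rw [hZ, Complex.sub_im, Complex.ofReal_im, sub_zero, hmap s hsI]
      exact hm₀le s hsI
    -- `‖Z' − Z‖ ≤ m₀/8`
    have hd : ‖Z' - Z‖ ≤ m₀ / 8 := by
      have h1 : dist (Loewner.map W s.toNNReal a) (Loewner.map U s.toNNReal a) ≤ m₀ / 16 :=
        (hKSW a ha).2 _ hs'S
      have h2 : |W s.toNNReal - U s.toNNReal| ≤ m₀ / 16 :=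
        (htube _ hs'S).trans (min_le_right _ _)
      have h3 : Z' - Z = (Loewner.map W s.toNNReal a - Loewner.map U s.toNNReal a) -
          ((W s.toNNReal - U s.toNNReal : ℝ) : ℂ) := by
        rw [hZ, hZ']; push_cast; ring
      rw [h3]
      calc ‖(Loewner.map W s.toNNReal a - Loewner.map U s.toNNReal a) -
              ((W s.toNNReal - U s.toNNReal : ℝ) : ℂ)‖
          ≤ ‖Loewner.map W s.toNNReal a - Loewner.map U s.toNNReal a‖ +
              ‖((W s.toNNReal - U s.toNNReal : ℝ) : ℂ)‖ := norm_sub_le _ _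
        _ ≤ m₀ / 16 + m₀ / 16 := by
            rw [← dist_eq_norm, Complex.norm_real, Real.norm_eq_abs]; exact add_le_add h1 h2
        _ = m₀ / 8 := by ring
    obtain ⟨hZ'im, hcmp⟩ := quarter_sq_div_le_of_near_c5 hm₀ hZim hd
    -- the slid hull is a `*`-hull containing `Z'`
    have hdisj : Disjoint (Loewner.closedHull W s.toNNReal) A := by
      rw [Set.disjoint_left]
      intro z hz hzA
      exact absurd ((haliveW z hzA).trans_le (hz.2.trans (WithTop.coe_le_coe.2 hs'S))) (lt_irrefl _)
    have hstar : IsStarHull (Loewner.slidHull W A s.toNNReal) :=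
      Loewner.isStarHull_slidHull_of_disjoint hW hA hdisj
    have hmem : Z' ∈ Loewner.slidHull W A s.toNNReal := Loewner.mem_slidHull_iff.2 ⟨a, ha, rfl⟩
    have hmass := sq_div_le_starBubbleMass hstar hmem hZ'im
    rw [← ENNReal.ofReal_mul (by norm_num)]
    exact ENNReal.ofReal_le_ofReal (hcmp.trans hmass)
  -- integrate
  calc ENNReal.ofReal q = ENNReal.ofReal (1 / 4 * (4 * q)) := by congr 1; ring
    _ = ENNReal.ofReal (1 / 4) * ENNReal.ofReal (4 * q) := ENNReal.ofReal_mul (by norm_num)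
    _ ≤ ENNReal.ofReal (1 / 4) * ∫⁻ s in Set.Ioc (0 : ℝ) S,
          ENNReal.ofReal (((Loewner.map U s.toNNReal a - U s.toNNReal).im /
            Complex.normSq (Loewner.map U s.toNNReal a - U s.toNNReal)) ^ 2 / 2) :=
        mul_le_mul_right hint _
    _ ≤ ∫⁻ s in Set.Ioc (0 : ℝ) S, ENNReal.ofReal (1 / 4) *
          ENNReal.ofReal (((Loewner.map U s.toNNReal a - U s.toNNReal).im /
            Complex.normSq (Loewner.map U s.toNNReal a - U s.toNNReal)) ^ 2 / 2) :=
        lintegral_const_mul_le _ _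
    _ ≤ ∫⁻ s in Set.Ioc (0 : ℝ) S, ENNReal.ofReal (starBubbleMass (Loewner.slidHull W A s.toNNReal)) := by
        refine lintegral_mono_ae ?_
        filter_upwards [ae_restrict_mem measurableSet_Ioc] with s hs
        exact hpt s hs

end Summit.CriticalPhenomena.SAWScalingLimit.Theorems.SubseqIdentification.BoundaryAreaLaw

end
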